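import Mathlib
import HarnessLib
import Summits.HubbardSuperconductivity.HubbardSuperconductivity.Theorems.KLProgrammeKLRegimeEnginePairTransferOutClassPlateau

/-!
# Route `KLProgramme` — ENGINE item stmt-HubbardSuperconductivity-20437 `KLRegimeEngineV17F2`, stub (c) value lane, «(c)-OUT»: the BORN-OVERLAP line of the rows door
# (flat, by name) and the REGIME TRICHOTOMY of a leg transfer (forward window / plateau / tail) that drives the case analysis of the member-ph lines
# (cell gate-hubbard-kl, seat hubbard-kl-k3c2-p2 g18; door map HOME/hubbard-kl-k3c2-p2/OUT-OF-CLASS-E2.md §2/§5/§6)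

* §1 **`born_member_row_flat_le`** — the born-overlap mass of the running member `Φ_j(t)` (`RS`'s weight in `klmd_defect_le_masses_family`):
  `(Λₙ−Λₙ₊₁)((βL²)³)⁻¹·Σ_{p σ}|ẇ(p)G(p)·Φ_j(t)(p)G(p)| ≤ 1024·15367` (`born_row_flat_le` × `klSoftMass_runningMember_le`), and with a multiplier
  `born_member_row_mul_flat_le` (`0 ≤ N ⇒ N·(…) ≤ N·(1024·15367)`) — the `B6` input of `outClass_increment_le_gainBar_*` with `B6 := M6·M2·(1024·15367)`; its SLOT
  (`legDressBarQ2`'s flat cubic × count vs `eremBar`'s `(Klam|U|)³·2⁻ⁿ`) is the (R171) question, left to the pen;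
* §2 **`legTransfer_trichotomy`** — for every `n` and `ρ ≥ 0`: `ρ < Λₙ₊₁·2⁻²⁴` (forward window) ∨ `Λₙ₊₁·2⁻²⁴ ≤ ρ ≤ 2²⁴Λₙ₊₁` (plateau) ∨ `2²⁴Λₙ₊₁ < ρ` (tail), and the
  consequences used by the member lines: `forward_window_small_transfer` (`G ≤ 2²¹ ⇒ G·ρ ≤ Λₙ₊₁/8` in the window) and `tail_threshold_of_gt`
  (`4 ≤ G ⇒ Λₙ₊₁/8 ≤ G·ρ` above the plateau).
Arithmetic over landed rows; nothing about the model is asserted; nothing asserts (E2″-F), (c), K3 or superconductivity.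
-/

noncomputable section

namespace Summit.HubbardSuperconductivity.HubbardSuperconductivity.Theorems.KLRegimeSplit

set_option linter.dupNamespace false -- summit = problem name (single-conjunct summit), D-0017

open Finset Matrix Set Literature.MathematicalPhysics.QuantumLattice Literature.Probability.LatticeModels GrassmannAlgebra
open Summit.HubbardSuperconductivity.HubbardSuperconductivity.Theorems.KLProgrammeLegKernels
open Summit.HubbardSuperconductivity.HubbardSuperconductivity.Theorems.TwoPointAssembly
open Summit.HubbardSuperconductivity.HubbardSuperconductivity.Theorems.DispersionFlow
open Summit.HubbardSuperconductivity.HubbardSuperconductivity.Theorems.KLRegimeWick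
open Summit.HubbardSuperconductivity.HubbardSuperconductivity.Theorems.EngineV8

/-! ## §1 The born-overlap mass of the running member, flat -/

section Born

variable {L M : ℕ} [NeZero L] [NeZero M] (β μ : ℝ) (K : TrigPolyC4v) {R : RenConsts} {U : ℝ} {N : ℕ}

/-- **Born-overlap mass of the running member, flat**: `(Λₙ−Λₙ₊₁)((βL²)³)⁻¹·Σ_{p σ}|ẇ(p)G(p)·Φ_j(t)(p)G(p)| ≤ 1024·15367` (`FrameOK`, `klBetaMin ≤ β ≤ L`, `n+1 ≤ j`). -/
theorem born_member_row_flat_le (hK : FrameOK R U N μ K) (hβm : klBetaMin ≤ β) (hβL : β ≤ L) (n : ℕ) {j : ℕ} (hj : n + 1 ≤ j)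
    {t : ℝ} (ht : t ∈ Icc (0 : ℝ) 1) :
    (klScale klE0 n - klScale klE0 (n + 1)) * ((β * (L : ℝ) ^ 2) ^ 3)⁻¹ *
      ∑ p : FreqMomentum L M, ∑ _σ : Fin 2,
        ‖((((deriv (fun Λ' : ℝ => hubbardCutoffWeightCT L M β μ K Λ' p) (klScale klE0 n + t * (klScale klE0 (n + 1) - klScale klE0 n)) : ℝ)) : ℂ) *
            (((β * (L : ℝ) ^ 2 : ℝ) : ℂ) * propCT L M β μ K p)) *
          ((((softSymbolCompl L M β μ K (n + 1) j p + (hubbardCutoffWeightCT L M β μ K (klScale klE0 (n + 1)) p -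
              hubbardCutoffWeightCT L M β μ K (klScale klE0 n + t * (klScale klE0 (n + 1) - klScale klE0 n)) p) : ℝ)) : ℂ) *
            (((β * (L : ℝ) ^ 2 : ℝ) : ℂ) * propCT L M β μ K p))‖ ≤ 1024 * 15367 := by
  have hβ : 0 < β := pos_of_klBetaMin_le hβm
  have h := born_row_flat_le β μ K hβ n ht (fun p => softSymbolCompl L M β μ K (n + 1) j p +
    (hubbardCutoffWeightCT L M β μ K (klScale klE0 (n + 1)) p - hubbardCutoffWeightCT L M β μ K (klScale klE0 n + t * (klScale klE0 (n + 1) - klScale klE0 n)) p))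
  have hms := klSoftMass_runningMember_le (L := L) (M := M) β μ K hK hβm hβL n hj ht
  exact h.trans (by linarith)

/-- With a nonnegative multiplier (the closer's `M6·M2`): `N·(born mass) ≤ N·(1024·15367)`. -/
theorem born_member_row_mul_flat_le (hK : FrameOK R U N μ K) (hβm : klBetaMin ≤ β) (hβL : β ≤ L) (n : ℕ) {j : ℕ} (hj : n + 1 ≤ j)
    {t : ℝ} (ht : t ∈ Icc (0 : ℝ) 1) {Nm : ℝ} (hN : 0 ≤ Nm) :
    Nm * ((klScale klE0 n - klScale klE0 (n + 1)) * ((β * (L : ℝ) ^ 2) ^ 3)⁻¹ *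
      ∑ p : FreqMomentum L M, ∑ _σ : Fin 2,
        ‖((((deriv (fun Λ' : ℝ => hubbardCutoffWeightCT L M β μ K Λ' p) (klScale klE0 n + t * (klScale klE0 (n + 1) - klScale klE0 n)) : ℝ)) : ℂ) *
            (((β * (L : ℝ) ^ 2 : ℝ) : ℂ) * propCT L M β μ K p)) *
          ((((softSymbolCompl L M β μ K (n + 1) j p + (hubbardCutoffWeightCT L M β μ K (klScale klE0 (n + 1)) p -
              hubbardCutoffWeightCT L M β μ K (klScale klE0 n + t * (klScale klE0 (n + 1) - klScale klE0 n)) p) : ℝ)) : ℂ) *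
            (((β * (L : ℝ) ^ 2 : ℝ) : ℂ) * propCT L M β μ K p))‖) ≤ Nm * (1024 * 15367) :=
  mul_le_mul_of_nonneg_left (born_member_row_flat_le β μ K hK hβm hβL n hj ht) hN

end Born

/-! ## §2 The regime trichotomy of a leg transfer -/

/-- **Trichotomy**: forward window `ρ < Λₙ₊₁·2⁻²⁴`, plateau `Λₙ₊₁·2⁻²⁴ ≤ ρ ≤ 2²⁴Λₙ₊₁`, or tail `2²⁴Λₙ₊₁ < ρ`. -/
theorem legTransfer_trichotomy (n : ℕ) (ρ : ℝ) :
    ρ < klScale klE0 (n + 1) * (2 ^ 24)⁻¹ ∨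
      (klScale klE0 (n + 1) * (2 ^ 24)⁻¹ ≤ ρ ∧ ρ ≤ 2 ^ 24 * klScale klE0 (n + 1)) ∨ 2 ^ 24 * klScale klE0 (n + 1) < ρ := by
  rcases lt_or_ge ρ (klScale klE0 (n + 1) * (2 ^ 24)⁻¹) with h | h
  · exact Or.inl h
  · rcases le_or_gt ρ (2 ^ 24 * klScale klE0 (n + 1)) with h' | h'
    · exact Or.inr (Or.inl ⟨h, h'⟩)
    · exact Or.inr (Or.inr h')

/-- In the forward window the signed rows' small-transfer hypothesis holds: `ρ < Λₙ₊₁·2⁻²⁴`, `G ≤ 2²¹` ⇒ `G·ρ ≤ Λₙ₊₁/8`. -/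
theorem forward_window_small_transfer {n : ℕ} {ρ G : ℝ} (hρ0 : 0 ≤ ρ) (hρ : ρ < klScale klE0 (n + 1) * (2 ^ 24)⁻¹) (hG : G ≤ 2 ^ 21) :
    G * ρ ≤ klScale klE0 (n + 1) / 8 := by
  have hΛ : 0 < klScale klE0 (n + 1) := klth_klScale_pos (n + 1)
  have h1 : G * ρ ≤ 2 ^ 21 * (klScale klE0 (n + 1) * (2 ^ 24)⁻¹) :=
    (mul_le_mul hG hρ.le hρ0 (by norm_num)).trans le_rfl
  have h2 : (2 : ℝ) ^ 21 * (klScale klE0 (n + 1) * (2 ^ 24)⁻¹) = klScale klE0 (n + 1) / 8 := by ring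
  linarith

/-- Above the plateau the two-shell threshold holds: `2²⁴Λₙ₊₁ < ρ`, `4 ≤ G` ⇒ `Λₙ₊₁/8 ≤ G·ρ`. -/
theorem tail_threshold_of_gt {n : ℕ} {ρ G : ℝ} (hρ : 2 ^ 24 * klScale klE0 (n + 1) < ρ) (hG : 4 ≤ G) : klScale klE0 (n + 1) / 8 ≤ G * ρ := by
  have hΛ : 0 < klScale klE0 (n + 1) := klth_klScale_pos (n + 1)
  have hρ0 : 0 ≤ ρ := by linarith [hΛ.le]
  nlinarith

/-- The band constant of an admissible frame is at most `2²¹` once `(8/3)·Gfr₁·U² ≤ 1` (a U-row): `G = 4 + (8/3)Gfr₁U² ≤ 5 ≤ 2²¹`. -/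
theorem bandLipschitz_le_two_pow {R : RenConsts} {U : ℝ} (h : 8 / 3 * R.Gfr 1 * U ^ 2 ≤ 1) : 4 + 8 / 3 * R.Gfr 1 * U ^ 2 ≤ 2 ^ 21 := by
  linarith

end Summit.HubbardSuperconductivity.HubbardSuperconductivity.Theorems.KLRegimeSplit

end
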